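import Summits.QuantumFields.YangMills.Theorems.BalabanUVNodesN15PerCubeGreenJetGreen
import HarnessLib

/-!
# N15 = NE2, road (c) — PROGRAMME (PC), (PC-A)+(PC-A′) IN ONE STATEMENT: ★★★★ ENTRIES 0 AND 2 OF [B9] (3.42) FOR THE NAMED `G′(U) = cGreen (cvT e U) a` AND EVERY `U(m)` BOND FIELD IN
# BAŁABAN's PRINTED CLASS (3.35) PER CUBE — `G′(U) ≤ B₀e^{−(δ∕16)d}` and `D_{U,μ}G′(U) ≤ (1·(1 + r_Vc_J) + π)·B₂·e^{−(δ∕16)d}` from ONE `Reg335Cube` datum per box (the two-collar box;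
# the class is monotone in its set), one set of constants (dag-n15-c g26, n15-c∕278)

Cell `pub-ymgap`, seat `pub-ymgap-dag-n15-c` (generation g26; R134 (a), s1; HUMAN RULING D-0062).  `bears_on: R4∕N15 · K3⁸ SpineGivenEndpointR13SepCoPHV (stmt-QuantumFields-27366)`;
filed `--kind proof --supports stmt-QuantumFields-27366 --as helper` — COUNT-NEUTRAL.  Two theorems, 0 `sorry`, no `def`.  Imports BY NAME n15-c∕276 `…PerCubeGreenJetGreen`
(`hasMaj_cgradGreen_of_reg335Box`; through it n15-c∕266 `hasMaj_cGreen_of_reg335Box`).  Nothing in the tree is modified.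

WHAT.  ★ `reg335Cube_anti` (r06's `Reg335Cube T U η Q ξ C` is antitone in the set `Q`: the class's gauge and potential on the bigger set serve on the smaller — so 266's one-collar datum
is implied by 276's two-collar datum).  ★★★★ `hasMaj_cGreen_jet_of_reg335Box2`: for odd `L ≥ 7`, `a₀ > 0`, colour index `ι` there are `δ, w₀, R₀, B₀, B₂ > 0`, `c_J ≥ 0` such that on every
doubled torus of the cover (`k ≥ 1`, `L^m ≥ w₀`), at King's mass, for trace-form `e`, EVERY `U(m)`-valued site bond field `U` with `Reg335Cube (· + e_μ) U L^{−k} Q²_k ξ C` on the two-collar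
box of each cut box and every `r_V` dominating the two explicit letter bounds with `r_V(1+|J⊕J|) + a₀|ι|(|ι|σ²+2σ) ≤ R₀`: `mulVecLin (cGreen (cvT e U) a) ≤ B₀·e^{−(δ∕16)|y−y′|_T}` AND, for
every `μ`, `pull_μ∘mulVecLin (cgrad (cvT e U) * cGreen (cvT e U) a) ≤ (1·(1 + r_Vc_J) + π)·B₂·e^{−(δ∕16)|y−y′|_T}` (`δ = min`, `w₀ = max`, `R₀ = min` of 266's and 276's; `c_J = e^{δ₂}c_r`).

HONEST FRAMING ∕ LIMITS.  Repackaging of LANDED theorems (266, 276) on MODEL carriers; the SHAPE of (3.42) entries 0 and 2 with per-cube gauges, NOT the printed theorem; entries 1, 3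
and the backward components not here; nothing of [B5]∕[B6]∕[B9] asserted.  NE2⁺ NOT PRINTED, NOT proved; N15 of record untouched (DISCHARGED AS CONSUMED, p687738); K3⁸ OPEN; counts of
record UNMOVED (typed 28∕28 · discharged 8∕27); one finite 𝕋⁴ at fixed ε per index — NOT infinite volume, NOT OS on ℝ⁴, NOT a mass gap, NOT Clay.  Restate-immune (no Theses import).
-/

noncomputable section

open scoped BigOperators Matrix Matrix.Norms.L2Operator

namespace Summit.QuantumFields.YangMills.BalabanUVNodes.N15.Gluing

open Real
open Literature.MathematicalPhysics.QuantumFieldTheory.Balaban1983to89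
open Literature.MathematicalPhysics.QuantumFieldTheory.Balaban1983to89.B5Prop11Plancherel (Tor fine unitVec)
open Literature.MathematicalPhysics.QuantumFieldTheory.Balaban1983to89.B11SectG (BlockNorm HasMaj)
open Literature.MathematicalPhysics.QuantumFieldTheory.Balaban1983to89.T4EtaRateCoeffDefect (pull)
open Literature.MathematicalPhysics.QuantumFieldTheory.Balaban1983to89.B6UnitTorusCarrier (unitTorusGeo unitTorusGeo_dist_nonneg)
open Literature.MathematicalPhysics.QuantumFieldTheory.Balaban1983to89.B9Eq335RegularityClasses (Reg335Cube)
open Literature.MathematicalPhysics.QuantumFieldTheory.King1986 (aK aK_pos)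
open Literature.MathematicalPhysics.QuantumFieldTheory.King1986.Torus (blockOf)
open Literature.Barriers.QuantumFields (traceForm)
open Summit.QuantumFields.YangMills.BalabanUVNodes.N15.BackgroundLayer (covLapM covLapM_apply)
open Summit.QuantumFields.YangMills.BalabanUVNodes.N15.MatrixSpecies (mmulOp coordMat basisConst liftEquiv covD)
open Summit.QuantumFields.YangMills.BalabanUVNodes.N15.TwoGrid (chiCube cubeBlocks)
open Summit.QuantumFields.YangMills.BalabanUVNodes.N15.CurvedSpecies (gaugePair gaugePair_inl gaugePair_inr uN_coordMat_conj_orthogonal)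
open Summit.QuantumFields.YangMills.BalabanUVNodes.N15.CovLandau (cgrad csavg claplA cGreen cgrad_mulVec claplA_mul_cGreen)

variable {d : ℕ}

section Anti

/-- ★ r06's per-cube class is ANTITONE IN THE SET: `Q' ⊆ Q` and `Reg335Cube T U η Q ξ C` ⟹ `Reg335Cube T U η Q' ξ C` (the same gauge and potential serve). [cite: Balaban1985BackgroundPropagators, (3.35) p.396 (shape)] -/
theorem reg335Cube_anti {𝔸 : Type*} [NormedRing 𝔸] [NormedAlgebra ℂ 𝔸] [CompleteSpace 𝔸] {S : Type*} {J : Type*} [Fintype J] [LinearOrder J] (T : J → Equiv.Perm S) (U : J → S → 𝔸ˣ)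
    {η : ℝ} {Q Q' : Set S} {ξ C : ℝ} (hQ : Q' ⊆ Q) (h : Reg335Cube T U η Q ξ C) : Reg335Cube T U η Q' ξ C := by
  obtain ⟨u, A, h1, h2, h3, h4⟩ := h
  exact ⟨u, A, fun z hz => h1 z (hQ hz), fun κ z hz => h2 κ z (hQ hz), fun κ z hz => h3 κ z (hQ hz), fun κ ν z hz => h4 κ ν z (hQ hz)⟩

end Anti

section Green

variable {L : ℕ} [NeZero L]

/-- ★★★★ **ENTRIES 0 AND 2 OF (3.42) FOR THE NAMED `G′(U)`, EVERY `U(m)` FIELD IN THE PRINTED PER-CUBE CLASS, ONE DATUM, ONE SET OF CONSTANTS**: n15-c∕266 (restricted from the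
two-collar to the one-collar box by `reg335Cube_anti`) and n15-c∕276 together.  MODEL carriers; the SHAPE of (3.42), not the printed theorem.
[cite: Balaban1985BackgroundPropagators, (3.42) p.397, (3.34)–(3.35) p.396, Cor. 3.6 p.408, Thm 3.7 (3.90) p.409 (shape ∕ mechanism)] -/
theorem hasMaj_cGreen_jet_of_reg335Box2 (hL : Odd L ∧ 1 < L) (hL7 : 7 ≤ L) {a₀ : ℝ} (ha₀ : 0 < a₀) (ι : Type) [Fintype ι] [DecidableEq ι] :
    ∃ δ w₀ R₀ B₀ B₂ cJ : ℝ, 0 < δ ∧ 0 < R₀ ∧ 0 < B₀ ∧ 0 < B₂ ∧ 0 ≤ cJ ∧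
      ∀ (mv kk : ℕ), 1 ≤ kk → w₀ ≤ ((L ^ mv : ℕ) : ℝ) →
      ∀ {mm : Type} [Fintype mm] [DecidableEq mm] [Nonempty mm] (e : Matrix mm mm ℂ ≃L[ℝ] (ι → ℝ)), (∀ A B : Matrix mm mm ℂ, traceForm A B = e A ⬝ᵥ e B) →
      ∀ (U : Fin (d + 1) → ScX d L mv kk hL → (Matrix mm mm ℂ)ˣ), (∀ μ x, (U μ x : Matrix mm mm ℂ) ∈ Matrix.unitaryGroup mm ℂ) →
      ∀ (ξ C : ℝ), 0 < ξ → 0 ≤ C →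
        (∀ k, Reg335Cube (scShift d L mv kk hL) U ((((L ^ kk : ℕ) : ℝ))⁻¹) {x : ScX d L mv kk hL | blockOf (L ^ kk) (cvM d L mv kk hL) x ∈ cubeBlocks (cvM d L mv kk hL) (coverCorner (cvM d L mv kk hL) (L ^ mv) L (2 * L ^ mv + 2) k) (6 * L ^ mv + 5)} ξ C) →
      ∀ (rV : ℝ), 0 ≤ rV →
        Fintype.card ι * (@basisConst ι _ (Matrix mm mm ℂ) Matrix.frobeniusNormedAddCommGroup Matrix.frobeniusNormedSpace e * (2 * Real.sqrt (Fintype.card mm)) * (Real.sqrt (Fintype.card mm) * ((C / ξ) * Real.exp (((((L ^ kk : ℕ) : ℝ))⁻¹) * (C / ξ))))) ≤ rV →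
        Fintype.card ι * (Fintype.card (Fin (d + 1)) * (Fintype.card ι * (@basisConst ι _ (Matrix mm mm ℂ) Matrix.frobeniusNormedAddCommGroup Matrix.frobeniusNormedSpace e * (2 * Real.sqrt (Fintype.card mm)) * (Real.sqrt (Fintype.card mm) * ((C / ξ) * Real.exp (((((L ^ kk : ℕ) : ℝ))⁻¹) * (C / ξ))))) ^ 2 + @basisConst ι _ (Matrix mm mm ℂ) Matrix.frobeniusNormedAddCommGroup Matrix.frobeniusNormedSpace e * (2 * Real.sqrt (Fintype.card mm)) * (Real.sqrt (Fintype.card mm) * ((C / ξ ^ 2) * Real.exp (((((L ^ kk : ℕ) : ℝ))⁻¹) * (C / ξ)))))) ≤ rV →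
        rV * (1 + Fintype.card (Fin (d + 1) ⊕ Fin (d + 1))) + a₀ * (Fintype.card ι * (Fintype.card ι * ((1 + rV * ((((L ^ kk : ℕ) : ℝ))⁻¹)) ^ ((d + 1) * L ^ kk) - 1) ^ 2 + 2 * ((1 + rV * ((((L ^ kk : ℕ) : ℝ))⁻¹)) ^ ((d + 1) * L ^ kk) - 1))) ≤ R₀ →
        HasMaj (ScNorm d L mv kk hL ι) (ScNorm d L mv kk hL ι)
            (Matrix.mulVecLin (cGreen (cvM d L mv kk hL) (L ^ kk) (cvT e (fun μ x => (U μ x : Matrix mm mm ℂ))) (aK a₀ (L : ℝ) kk * (((L ^ kk : ℕ) : ℝ)) ^ (d + 1))))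
          (fun y y' => B₀ * Real.exp (-(δ / 16 * (unitTorusGeo L kk (cvM d L mv kk hL)).dist y y'))) ∧
        ∀ μ : Fin (d + 1), HasMaj (ScNorm d L mv kk hL ι) (ScNorm d L mv kk hL ι)
          (pull (fun p : ScX d L mv kk hL × ι => ((p.1, μ), p.2)) ∘ₗ
            Matrix.mulVecLin (cgrad (cvM d L mv kk hL) (L ^ kk) (cvT e (fun μ x => (U μ x : Matrix mm mm ℂ))) * cGreen (cvM d L mv kk hL) (L ^ kk) (cvT e (fun μ x => (U μ x : Matrix mm mm ℂ))) (aK a₀ (L : ℝ) kk * (((L ^ kk : ℕ) : ℝ)) ^ (d + 1))))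
          (fun y y' => (1 * (1 + rV * cJ) + π) * B₂ * Real.exp (-(δ / 16 * (unitTorusGeo L kk (cvM d L mv kk hL)).dist y y'))) := by
  obtain ⟨δ₀, w₀, R₀, B₀, hδ₀, hR₀, hB₀, H0⟩ := hasMaj_cGreen_of_reg335Box (d := d) hL hL7 ha₀ ι
  obtain ⟨δ₂, w₂, R₂, B₂, cR, hδ₂, hR₂, hB₂, hcR, H2⟩ := hasMaj_cgradGreen_of_reg335Box (d := d) hL hL7 ha₀ ι
  refine ⟨min δ₀ δ₂, max (max w₀ w₂) 2, min R₀ R₂, B₀, B₂, Real.exp δ₂ * cR, lt_min hδ₀ hδ₂, lt_min hR₀ hR₂, hB₀, hB₂, by positivity, fun mv kk hk hw₀ => ?_⟩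
  intro mm _ _ _ e he U hU ξ C hξ hC h335 rV hrV hrA hrC hRle
  have hw₀' : w₀ ≤ ((L ^ mv : ℕ) : ℝ) := ((le_max_left _ _).trans (le_max_left _ _)).trans hw₀
  have hw₂' : w₂ ≤ ((L ^ mv : ℕ) : ℝ) := ((le_max_right _ _).trans (le_max_left _ _)).trans hw₀
  have hW2 : 2 ≤ L ^ mv := by have h := (le_max_right (max w₀ w₂) 2).trans hw₀; exact_mod_cast h
  have hM : ∀ ν, cvM d L mv kk hL ν = 2 * L * L ^ mv := MP_succ_eq L mv kk hL
  have hS5 : 6 * L ^ mv + 5 ≤ 2 * L * L ^ mv := by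
    have h7 : 7 * L ^ mv ≤ L * L ^ mv := Nat.mul_le_mul_right _ hL7
    have e2 : 2 * L * L ^ mv = 2 * (L * L ^ mv) := by ring
    rw [e2]; omega
  -- the one-collar datum from the two-collar datum
  have h335' : ∀ k, Reg335Cube (scShift d L mv kk hL) U ((((L ^ kk : ℕ) : ℝ))⁻¹) {x : ScX d L mv kk hL | blockOf (L ^ kk) (cvM d L mv kk hL) x ∈ cubeBlocks (cvM d L mv kk hL) (coverCorner (cvM d L mv kk hL) (L ^ mv) L (2 * L ^ mv + 1) k) (6 * L ^ mv + 3)} ξ C := fun k =>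
    reg335Cube_anti (scShift d L mv kk hL) U (fun x hx => mem_cubeBlocks_of_mem_inner (m₀ := 2 * L ^ mv + 2) (S₀ := 6 * L ^ mv + 5) hM (by omega) (by omega) hS5 hx) (h335 k)
  have hd0 : ∀ y y', 0 ≤ (unitTorusGeo L kk (cvM d L mv kk hL)).dist y y' := fun y y' => unitTorusGeo_dist_nonneg L kk _ y y'
  refine ⟨?_, fun μ => ?_⟩
  · refine (H0 mv kk hk hw₀' e he U hU ξ C hξ hC h335' rV hrV hrA hrC (hRle.trans (min_le_left _ _))).mono fun y y' => ?_
    refine mul_le_mul_of_nonneg_left (Real.exp_le_exp.mpr ?_) hB₀.le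
    have := mul_le_mul_of_nonneg_right (min_le_left δ₀ δ₂) (hd0 y y')
    linarith
  · refine (H2 mv kk hk hw₂' e he U hU ξ C hξ hC h335 rV hrV hrA hrC (hRle.trans (min_le_right _ _)) μ).mono fun y y' => ?_
    rw [show 1 * (1 + rV * Real.exp δ₂ * cR) + π = 1 * (1 + rV * (Real.exp δ₂ * cR)) + π by ring]
    refine mul_le_mul_of_nonneg_left (Real.exp_le_exp.mpr ?_) (by positivity)
    have := mul_le_mul_of_nonneg_right (min_le_right δ₀ δ₂) (hd0 y y')
    linarith

end Green

end Summit.QuantumFields.YangMills.BalabanUVNodes.N15.Gluing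

end
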